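import Summits.KontsevichZagierPeriods.KontsevichZagierPeriods.Cruxes.ExactDescentBox.ExactDescentBoxProofAux

/-!
# `ExactDescentBox` (stmt-KontsevichZagierPeriods-4427, route GenericPointClass) — part 3/3: the affine chart, descent along one coordinate (cube, then box) and the assembly `exactDescentBox_proof`

Part of the complete candidate proof `Cruxes/ExactDescentBox/ExactDescentBoxProof.lean` (strategist seat
planner-cstrat-stmt-KontsevichZagierPeriods-4427-s2-0, 2026-08-17; lean check rc 0, 0 sorry, axioms std), pre-split into
three ≤ 400-line files for landing as `Theorems/GenericPointClassExactDescentBox{Cube,Aux,}.lean` (PROVER: rename the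
module paths in the `import` lines accordingly; nothing else changes).

§4 the diagonal affine chart `x ↦ a + (b − a)·x`, §3 `cubeSingleCoordinateDescent`, §5 `boxSingleCoordinateDescent`,
§6 `Summit.KontsevichZagierPeriods.GenericPointClass.exactDescentBox_proof : ExactDescentBox`
(closes stmt-4427).

References: M. Kontsevich, D. Zagier, *Periods* (2001), §1.2, rules (1)–(3); A. Huber, S. Müller-Stach, *Periods and
Nori Motives* (2017), §13.1; J. Bochnak, M. Coste, M.-F. Roy, *Real Algebraic Geometry* (1998), §2.2.
-/

noncomputable section

open MeasureTheory Set
open Literature.NumberTheory.Transcendental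
open Literature.NumberTheory.Transcendental.KZ (IntegralRep of relations changeOfVariablesRel_subset_relations)
open Literature.ModelTheory.ExponentialFields (IsSemialgebraic)
open Summit.KontsevichZagierPeriods.GaussManinCertificates
  (isAlgebraic_corner_of_isSemialgebraic_openBox isSemialgebraic_openBox_of_isAlgebraic)
open Summit.KontsevichZagierPeriods.KontsevichZagierPeriods.Cruxes.StokesGeneration.FibrewiseStokes
  (boxAff_isSemialgebraicMapOn boxAff_isAlgebraic_prod boxAff_injective boxAff_diag_det boxAff_hasFDerivAt)

namespace Summit.KontsevichZagierPeriods.GenericPointClass.ExactDescentBox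

variable {d : ℕ}

/-! ### §4 The diagonal affine chart `x ↦ a + (b − a)·x` -/

/-- The affine chart commutes with updating a coordinate. [folklore] -/
theorem boxAff_update (a b : Fin (d + 1) → ℝ) (x : Fin (d + 1) → ℝ) (k : Fin (d + 1)) (t : ℝ) :
    (fun i => a i + (b i - a i) * Function.update x k t i) =
      Function.update (fun i => a i + (b i - a i) * x i) k (a k + (b k - a k) * t) := by
  funext i
  by_cases hik : i = k
  · subst hik
    simp
  · simp [Function.update_of_ne hik]

/-- The affine chart commutes with inserting a coordinate: `Φ (insertNth k c y) =
insertNth k (a_k + (b_k − a_k) c) (Φ_k y)`, `Φ_k` the chart of the `k`-th face. [folklore] -/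
theorem boxAff_insertNth (a b : Fin (d + 1) → ℝ) (k : Fin (d + 1)) (c : ℝ) (y : Fin d → ℝ) :
    (fun i => a i + (b i - a i) * (Fin.insertNth k c y : Fin (d + 1) → ℝ) i) =
      (Fin.insertNth k (a k + (b k - a k) * c)
        (fun j => a (k.succAbove j) + (b (k.succAbove j) - a (k.succAbove j)) * y j) :
          Fin (d + 1) → ℝ) := by
  funext i
  rcases Fin.eq_self_or_eq_succAbove k i with rfl | ⟨j, rfl⟩
  · simp [Fin.insertNth_apply_same]
  · simp [Fin.insertNth_apply_succAbove]

/-- The affine chart maps the open unit cube into the open box. [folklore] -/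
theorem boxAff_mem_openBox {N : ℕ} {a b : Fin N → ℝ} (hab : ∀ i, a i < b i) {x : Fin N → ℝ}
    (hx : x ∈ {x : Fin N → ℝ | ∀ i, x i ∈ Ioo (0 : ℝ) 1}) :
    (fun i => a i + (b i - a i) * x i) ∈ {z : Fin N → ℝ | ∀ i, z i ∈ Ioo (a i) (b i)} := by
  intro i
  have h0 := (hx i).1
  have h1 := (hx i).2
  have hd := sub_pos.2 (hab i)
  constructor <;> nlinarith

/-- The affine chart maps the closed unit cube into the closed box. [folklore] -/
theorem boxAff_mem_closedBox {N : ℕ} {a b : Fin N → ℝ} (hab : ∀ i, a i < b i) {x : Fin N → ℝ}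
    (hx : x ∈ Icc (0 : Fin N → ℝ) 1) :
    (fun i => a i + (b i - a i) * x i) ∈ {z : Fin N → ℝ | ∀ j, z j ∈ Icc (a j) (b j)} := by
  rw [mem_Icc, Pi.le_def, Pi.le_def] at hx
  intro i
  have h0 := hx.1 i
  have h1 := hx.2 i
  simp only [Pi.zero_apply, Pi.one_apply] at h0 h1
  have hd := sub_pos.2 (hab i)
  constructor <;> nlinarith

/-- The affine chart is continuous. [folklore] -/
theorem continuous_boxAff {N : ℕ} (a b : Fin N → ℝ) :
    Continuous (fun x : Fin N → ℝ => fun i => a i + (b i - a i) * x i) :=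
  continuous_pi fun i => continuous_const.add (continuous_const.mul (continuous_apply i))

/-! ### §3 Descent along one coordinate on the unit cube -/

/-- **Descent along one coordinate `k` on the open unit cube** from stubs 2 and 3: an integrand
`B'` which is `∂B/∂x_k` for a potential `B` semialgebraic and continuous on the closed cube descends
to the face representation `[(0,1)ⁿ, B(x_k = 1) − B(x_k = 0)]`. The potential and its derivative are
transported through the coordinate cycle `z ↦ insertNth k (z last) (init z)`; stub 2 moves the bulk,
stub 3 descends the cycled bulk to the two honest faces (`exists_faceRep`), rule (1b) recombines
them into the given face representation. [cite: KontsevichZagier2001, §1.2] -/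
theorem cubeSingleCoordinateDescent (h₂ : CubeCoordinateCycle) (h₃ : CubeLastNewtonLeibniz)
    (n : ℕ) (k : Fin (n + 1)) (B B' : (Fin (n + 1) → ℝ) → ℝ) (R : KZ.IntegralRep (n + 1))
    (s : KZ.IntegralRep n)
    (hRd : R.domain = {x : Fin (n + 1) → ℝ | ∀ i, x i ∈ Ioo (0 : ℝ) 1})
    (hB : IsSemialgebraicFunOn ℚ (Icc (0 : Fin (n + 1) → ℝ) 1) B)
    (hBc : ContinuousOn B (Icc (0 : Fin (n + 1) → ℝ) 1))
    (hder : ∀ z ∈ R.domain, HasDerivAt (fun t : ℝ => B (Function.update z k t)) (B' z) (z k))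
    (hRi : EqOn R.integrand B' R.domain)
    (hsd : s.domain = {y : Fin n → ℝ | ∀ i, y i ∈ Ioo (0 : ℝ) 1})
    (hsi : EqOn s.integrand (fun y => B (Fin.insertNth k 1 y) - B (Fin.insertNth k 0 y)) s.domain) :
    KZ.of R - KZ.of s ∈ KZ.relations := by
  obtain ⟨e, he⟩ := exists_perm_insertNth (d := n) k
  have hU : IsSemialgebraic ℚ {x : Fin (n + 1) → ℝ | ∀ i, x i ∈ Ioo (0 : ℝ) 1} :=
    KZ.isSemialgebraic_unitCube (n + 1)
  -- (a) the derivative on the open cube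
  have hB'sa : IsSemialgebraicFunOn ℚ {x : Fin (n + 1) → ℝ | ∀ i, x i ∈ Ioo (0 : ℝ) 1} B' := by
    have h := R.isSemialgebraicFunOn_integrand.congr hRi
    rwa [hRd] at h
  have hB'int : IntegrableOn B' {x : Fin (n + 1) → ℝ | ∀ i, x i ∈ Ioo (0 : ℝ) 1} := by
    have h := R.integrableOn.congr_fun hRi (KZ.IntegralRep.measurableSet_domain_holds R)
    rwa [hRd] at h
  -- (b) transport through the coordinate cycle
  have hCsa : IsSemialgebraicFunOn ℚ (Icc (0 : Fin (n + 1) → ℝ) 1)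
      (fun z => B (Fin.insertNth k (z (Fin.last n)) (Fin.init z))) :=
    (isSemialgebraicFunOn_comp_perm_Icc e hB).congr fun z _ => congrArg B (he z)
  have hC'sa : IsSemialgebraicFunOn ℚ {x : Fin (n + 1) → ℝ | ∀ i, x i ∈ Ioo (0 : ℝ) 1}
      (fun z => B' (Fin.insertNth k (z (Fin.last n)) (Fin.init z))) :=
    (isSemialgebraicFunOn_comp_perm_setOf e hB'sa).congr fun z _ => congrArg B' (he z)
  have hC'int : IntegrableOn (fun z => B' (Fin.insertNth k (z (Fin.last n)) (Fin.init z)))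
      {x : Fin (n + 1) → ℝ | ∀ i, x i ∈ Ioo (0 : ℝ) 1} :=
    (integrableOn_comp_perm_setOf e hB'int).congr_fun (fun z _ => congrArg B' (he z))
      (KZ.isOpen_unitCube (n + 1)).measurableSet
  have hCcont : ContinuousOn (fun z => B (Fin.insertNth k (z (Fin.last n)) (Fin.init z)))
      (Icc (0 : Fin (n + 1) → ℝ) 1) := by
    have h : ContinuousOn (fun z : Fin (n + 1) → ℝ => B (fun i => z (e i)))
        (Icc (0 : Fin (n + 1) → ℝ) 1) :=
      hBc.comp (continuous_comp_perm e).continuousOn fun z hz => (comp_perm_mem_Icc_iff e z).2 hz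
    exact h.congr fun z _ => (congrArg B (he z)).symm
  have hCder : ∀ y ∈ {y : Fin n → ℝ | ∀ i, y i ∈ Ioo (0 : ℝ) 1}, ∀ t ∈ Ioo (0 : ℝ) 1,
      HasDerivAt
        (fun σ : ℝ => B (Fin.insertNth k ((Fin.snoc y σ : Fin (n + 1) → ℝ) (Fin.last n))
          (Fin.init (Fin.snoc y σ : Fin (n + 1) → ℝ))))
        (B' (Fin.insertNth k ((Fin.snoc y t : Fin (n + 1) → ℝ) (Fin.last n))
          (Fin.init (Fin.snoc y t : Fin (n + 1) → ℝ)))) t := by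
    intro y hy t ht
    simp only [Fin.snoc_last, Fin.init_snoc]
    have hx : (Fin.insertNth k t y : Fin (n + 1) → ℝ) ∈ R.domain := by
      rw [hRd]
      exact insertNth_mem_setOf k ht hy
    have h := hder _ hx
    simp only [Fin.insertNth_apply_same, update_insertNth] at h
    exact h
  -- (c) the cycled bulk representation and stub 2
  let Rt : KZ.IntegralRep (n + 1) :=
    { domain := {x | ∀ i, x i ∈ Ioo (0 : ℝ) 1}
      integrand := fun z => B' (Fin.insertNth k (z (Fin.last n)) (Fin.init z))
      isSemialgebraic_domain := hU
      isSemialgebraicFunOn_integrand := hC'sa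
      integrableOn := hC'int }
  have hcyc : KZ.of R - KZ.of Rt ∈ KZ.relations := by
    refine h₂ n k R Rt hRd rfl fun z hz => ?_
    have hmem : (Fin.insertNth k (z (Fin.last n)) (Fin.init z) : Fin (n + 1) → ℝ) ∈ R.domain := by
      rw [hRd, ← he z]
      exact (comp_perm_mem_setOf_iff e z).2 hz
    exact (hRi hmem).symm
  -- (d) the two honest faces and stub 3
  obtain ⟨r₀, hr₀d, hr₀i⟩ := exists_faceRep (d := n) k 0 (by norm_num) hB hBc
  obtain ⟨r₁, hr₁d, hr₁i⟩ := exists_faceRep (d := n) k 1 (by norm_num) hB hBc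
  have hNL : KZ.of Rt - KZ.of r₁ + KZ.of r₀ ∈ KZ.relations := by
    refine h₃ n (fun z => B (Fin.insertNth k (z (Fin.last n)) (Fin.init z)))
      (fun z => B' (Fin.insertNth k (z (Fin.last n)) (Fin.init z))) Rt r₀ r₁ hCsa hCcont hCder rfl
      (fun _ _ => rfl) hr₀d hr₁d ?_ ?_
    · intro y _
      rw [hr₀i]
      simp
    · intro y _
      rw [hr₁i]
      simp
  -- (e) recombine the two faces into the given face representation
  have hsplit : KZ.of s - KZ.of r₁ - KZ.of r₀.neg ∈ KZ.relations := by
    refine KZ.integrandAddRel_subset_relations ⟨n, s, r₁, r₀.neg, by rw [hr₁d, hsd],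
      by rw [KZ.IntegralRep.domain_neg, hr₀d, hsd], fun y hy => ?_, rfl⟩
    rw [hsi hy, Pi.add_apply, KZ.IntegralRep.integrand_neg, Pi.neg_apply, hr₁i, hr₀i]
    simp only [Rat.cast_one, Rat.cast_zero]
    ring
  have hneg : KZ.of r₀.neg + KZ.of r₀ ∈ KZ.relations := by
    have h := KZ.of_add_of_mem_relations_of_eqOn_neg (r := r₀) (r' := r₀.neg)
      (KZ.IntegralRep.domain_neg r₀) (fun x _ => by rw [KZ.IntegralRep.integrand_neg])
    rwa [add_comm] at h
  have key : KZ.of R - KZ.of s = (KZ.of R - KZ.of Rt) + (KZ.of Rt - KZ.of r₁ + KZ.of r₀) -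
      (KZ.of s - KZ.of r₁ - KZ.of r₀.neg) - (KZ.of r₀.neg + KZ.of r₀) := by
    abel
  rw [key]
  exact KZ.relations.sub_mem (KZ.relations.sub_mem (KZ.relations.add_mem hcyc hNL) hsplit) hneg

/-! ### §5 Descent along one coordinate on a box -/

/-- **Descent along one coordinate `k` on an open box** from the three stubs: on
`∏ (aᵢ, bᵢ)`, an integrand `A'` which is `∂A/∂z_k` for a potential `A` semialgebraic and continuous
on the closed box descends to the face representation `[open face box, A(z_k = b_k) − A(z_k = a_k)]`.
Stub 1 moves the bulk to the unit cube (Jacobian `J = ∏ (bᵢ − aᵢ)`) and the face to the unit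
`n`-cube (Jacobian `J_k = ∏_{j ≠ k} (b_j − a_j)`); the cube potential `J_k · (A ∘ Φ)` has
`k`-derivative `J · (A' ∘ Φ)` (one-variable chain rule, `J = (b_k − a_k) J_k`) and faces
`J_k · A(z_k = b_k) ∘ Φ_k`, `J_k · A(z_k = a_k) ∘ Φ_k`; `cubeSingleCoordinateDescent` does the rest.
[cite: KontsevichZagier2001, §1.2] -/
theorem boxSingleCoordinateDescent (h₁ : OpenBoxToCube) (h₂ : CubeCoordinateCycle)
    (h₃ : CubeLastNewtonLeibniz)
    (n : ℕ) (k : Fin (n + 1)) (a b : Fin (n + 1) → ℝ) (A A' : (Fin (n + 1) → ℝ) → ℝ)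
    (R : KZ.IntegralRep (n + 1)) (s : KZ.IntegralRep n)
    (hab : ∀ i, a i < b i)
    (hRd : R.domain = {z | ∀ i, z i ∈ Set.Ioo (a i) (b i)})
    (hA : IsSemialgebraicFunOn ℚ {z | ∀ j, z j ∈ Set.Icc (a j) (b j)} A)
    (hAc : ContinuousOn A {z | ∀ j, z j ∈ Set.Icc (a j) (b j)})
    (hder : ∀ z ∈ R.domain, HasDerivAt (fun t : ℝ => A (Function.update z k t)) (A' z) (z k))
    (hRi : Set.EqOn R.integrand A' R.domain)
    (hsd : s.domain = {y | ∀ j, y j ∈ Set.Ioo (a (Fin.succAbove k j)) (b (Fin.succAbove k j))})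
    (hsi : Set.EqOn s.integrand (fun y => A (Fin.insertNth k (b k) y) - A (Fin.insertNth k (a k) y))
      s.domain) :
    KZ.of R - KZ.of s ∈ KZ.relations := by
  -- the corners are algebraic
  have halg : ∀ i, IsAlgebraic ℚ (a i) ∧ IsAlgebraic ℚ (b i) :=
    isAlgebraic_corner_of_isSemialgebraic_openBox hab (hRd ▸ R.isSemialgebraic_domain)
  have habk : ∀ j : Fin n, a (k.succAbove j) < b (k.succAbove j) := fun j => hab _
  -- (i) stub 1 on the bulk and on the face
  obtain ⟨T, hTd, hTi, hRT⟩ :=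
    h₁ (n + 1) a b R (fun i => (halg i).1) (fun i => (halg i).2) hab hRd
  obtain ⟨T', hT'd, hT'i, hsT'⟩ :=
    h₁ n (fun j => a (k.succAbove j)) (fun j => b (k.succAbove j)) s (fun j => (halg _).1)
      (fun j => (halg _).2) habk hsd
  -- Jacobians
  set J : ℝ := ∏ i, (b i - a i) with hJ
  set Jk : ℝ := ∏ j : Fin n, (b (k.succAbove j) - a (k.succAbove j)) with hJk
  have hJJk : J = (b k - a k) * Jk := by
    rw [hJ, Fin.prod_univ_succAbove _ k]
  have hJk_alg : IsAlgebraic ℚ Jk :=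
    boxAff_isAlgebraic_prod (fun j => (halg (k.succAbove j)).1) fun j => (halg (k.succAbove j)).2
  -- (ii) the cube potential `B = J_k · (A ∘ Φ)` and its data
  have hCube : IsSemialgebraic ℚ (Icc (0 : Fin (n + 1) → ℝ) 1) := by
    rw [← KZ.cube_eq_Icc]
    exact KZ.isSemialgebraic_cube
  have hΦsa : IsSemialgebraicMapOn ℚ (Icc (0 : Fin (n + 1) → ℝ) 1)
      (fun x : Fin (n + 1) → ℝ => fun i => a i + (b i - a i) * x i) :=
    boxAff_isSemialgebraicMapOn hCube (fun i => (halg i).1) fun i => (halg i).2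
  have hB : IsSemialgebraicFunOn ℚ (Icc (0 : Fin (n + 1) → ℝ) 1)
      (fun x => Jk * A (fun i => a i + (b i - a i) * x i)) :=
    (isSemialgebraicFunOn_const_of_isAlgebraic hCube hJk_alg).fun_mul
      ((IsSemialgebraicFunOn.comp_isSemialgebraicMapOn_holds hA hΦsa
        fun x hx => boxAff_mem_closedBox hab hx).congr fun _ _ => rfl)
  have hBc : ContinuousOn (fun x => Jk * A (fun i => a i + (b i - a i) * x i))
      (Icc (0 : Fin (n + 1) → ℝ) 1) :=
    continuousOn_const.mul
      (hAc.comp (continuous_boxAff a b).continuousOn fun x hx => boxAff_mem_closedBox hab hx)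
  have hder' : ∀ x ∈ T.domain,
      HasDerivAt (fun t : ℝ => Jk * A (fun i => a i + (b i - a i) * Function.update x k t i))
        (J * A' (fun i => a i + (b i - a i) * x i)) (x k) := by
    intro x hx
    rw [hTd] at hx
    have hΦx : (fun i => a i + (b i - a i) * x i) ∈ R.domain := by
      rw [hRd]
      exact boxAff_mem_openBox hab hx
    have hg := hder _ hΦx
    have hh : HasDerivAt (fun t : ℝ => a k + (b k - a k) * t) (b k - a k) (x k) := by
      simpa using ((hasDerivAt_id (x k)).const_mul (b k - a k)).const_add (a k)
    have hcomp := hg.comp (x k) hh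
    have hfun : (fun t : ℝ => Jk * A (fun i => a i + (b i - a i) * Function.update x k t i)) =
        fun t => Jk * ((fun t => A (Function.update (fun i => a i + (b i - a i) * x i) k t)) ∘
          (fun t => a k + (b k - a k) * t)) t := by
      funext t
      simp only [Function.comp_apply, boxAff_update]
    rw [hfun]
    refine (hcomp.const_mul Jk).congr_deriv ?_
    rw [hJJk]
    ring
  have hTi' : EqOn T.integrand (fun x => J * A' (fun i => a i + (b i - a i) * x i)) T.domain := by
    intro x hx
    have hΦx : (fun i => a i + (b i - a i) * x i) ∈ R.domain := by
      rw [hRd]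
      exact boxAff_mem_openBox hab (hTd ▸ hx)
    rw [hTi x hx, hRi hΦx]
  have hT'i' : EqOn T'.integrand
      (fun y => Jk * A (fun i => a i + (b i - a i) * (Fin.insertNth k 1 y : Fin (n + 1) → ℝ) i) -
        Jk * A (fun i => a i + (b i - a i) * (Fin.insertNth k 0 y : Fin (n + 1) → ℝ) i)) T'.domain := by
    intro y hy
    have hΦy : (fun j => a (k.succAbove j) + (b (k.succAbove j) - a (k.succAbove j)) * y j) ∈
        s.domain := by
      rw [hsd]
      exact boxAff_mem_openBox habk (hT'd ▸ hy)
    have h1 : a k + (b k - a k) * 1 = b k := by ring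
    have h0 : a k + (b k - a k) * 0 = a k := by ring
    simp only [boxAff_insertNth, h1, h0]
    rw [hT'i y hy, hsi hΦy]
    ring
  -- (iii) the cube engine between the two cubified representations
  have hmid : KZ.of T - KZ.of T' ∈ KZ.relations :=
    cubeSingleCoordinateDescent h₂ h₃ n k (fun x => Jk * A (fun i => a i + (b i - a i) * x i))
      (fun x => J * A' (fun i => a i + (b i - a i) * x i)) T T' hTd hB hBc hder' hTi' hT'd hT'i'
  have key : KZ.of R - KZ.of s = (KZ.of R - KZ.of T) + (KZ.of T - KZ.of T') - (KZ.of s - KZ.of T') := by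
    abel
  rw [key]
  exact KZ.relations.sub_mem (KZ.relations.add_mem hRT hmid) hsT'

end Summit.KontsevichZagierPeriods.GenericPointClass.ExactDescentBox

/-! ### §6 The assembly -/

namespace Summit.KontsevichZagierPeriods.GenericPointClass

open Summit.KontsevichZagierPeriods.GenericPointClass.ExactDescentBox

/-- **Settles stmt-KontsevichZagierPeriods-4427 (`ExactDescentBox`, Theorem B on boxes).** Split
`[box, ∑ᵢ ∂ᵢAᵢ]` into the pieces `[box, ∂ᵢAᵢ]` (iterated rule (1b), the tree theorem
`KZ.of_sub_sum_integrand_mem_relations`), descend each piece along its own coordinate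
(`boxSingleCoordinateDescent` fed with the three proved pieces `openBoxToCube_proof` (§1) and the cube
engine `cubeCoordinateCycle_holds` / `cubeLastNewtonLeibniz_holds` (§0, items stmt-17772 / stmt-17771 of
route CobordismMove)), and add up in `KZ.relations`. [cite: KontsevichZagier2001, §1.2] -/
theorem exactDescentBox_proof :
    Summit.KontsevichZagierPeriods.KontsevichZagierPeriods.Theses.GenericPointClass.ExactDescentBox := by
  intro n a b r A A' s hab hdom hA hAc hder hA' hint hsum hsd hsi
  -- the per-coordinate pieces `[box, ∂ᵢ Aᵢ]`
  let R : Fin (n + 1) → KZ.IntegralRep (n + 1) := fun i =>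
    { domain := r.domain
      integrand := A' i
      isSemialgebraic_domain := r.isSemialgebraic_domain
      isSemialgebraicFunOn_integrand := hA' i
      integrableOn := hint i }
  have hsplit : KZ.of r - ∑ i, KZ.of (R i) ∈ KZ.relations :=
    KZ.of_sub_sum_integrand_mem_relations Finset.univ R r (fun _ _ => rfl)
      (fun z hz => by simpa [R] using hsum hz)
  have hdesc : ∀ i, KZ.of (R i) - KZ.of (s i) ∈ KZ.relations := fun i =>
    boxSingleCoordinateDescent openBoxToCube_proof cubeCoordinateCycle_holds cubeLastNewtonLeibniz_holds
      n i a b (A i) (A' i) (R i) (s i) hab hdom (hA i) (hAc i) (hder i) (fun _ _ => rfl) (hsd i) (hsi i)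
  have heq : KZ.of r - ∑ i, KZ.of (s i) =
      (KZ.of r - ∑ i, KZ.of (R i)) + ∑ i, (KZ.of (R i) - KZ.of (s i)) := by
    rw [Finset.sum_sub_distrib]
    abel
  rw [heq]
  exact KZ.relations.add_mem hsplit (sum_mem fun i _ => hdesc i)

end Summit.KontsevichZagierPeriods.GenericPointClass
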